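import Literature.NumberTheory.Rogawski1990.LocalStableClassesNonsplit            -- ★ L4a FILE 1: `twistGram` eigenframe algebra over a field
import Literature.NumberTheory.Rogawski1990.CartanRealisation                    -- ★ `det_twistGram`
import Literature.NumberTheory.Automorphic.LocalUnitaryGroupCongr                -- ★ `local_eq_unitaryGroupOfForm_map`
import Literature.NumberTheory.Automorphic.UnitaryGroupNonsplitPlace             -- ★ `LocalRing.isField_of_smul_eq`
import Literature.NumberTheory.Rogawski1990.ExplicitFactorKappaAlmostEverywhereOne -- ★ `conjLocal_apply_eq_galAdicCompletionMap`
import HarnessLib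

/-!
# Norm-one eigenvalues from ellipticity: a rank-2 unitary element with a hyperbolic eigenvalue pair is `U(Φ₂)`-conjugate to the diagonal torus (a Levi)
# (Rogawski 1990, §3.5–§3.6 pp. 29–31; Flicker 1998, §6 p. 95)

Topic `NumberTheory/Rogawski1990`; namespace `Literature.NumberTheory.Rogawski1990`.  THEOREMS ONLY (no definition, no instance, no notation, no named fact, no
`sorry`; count-neutral).  Cell `pub/hodgecm-mathlib`, F0∕P3a road «D-N7-inert», line «N7nsCount» (`stub_countSplitClause`), brick **(E3) «NORM-ONE EIGENVALUES FROM
`hell`»** of B-p10 (g24)'s (S1-bis) «H-value in the stub frame» and p04 (g12)'s (F12) HEAD 3 (architect A-p06 (g26) 2026-09-01T04:34:25Z (B); LEAD F0P3a-plan (g9)).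
HONEST LABEL: HC_CM is proved only modulo the printed citations until rung 0 closes; elementary hermitian linear algebra here.

THE MATHEMATICS.  `K` a field with an involution `σ`, `H ∈ M₂(K)` `σ`-hermitian non-degenerate, `γ ∈ U(σ, H)` with an eigenframe `γ P = P · diag(u)`, `u₀ ≠ u₁`
(split characteristic polynomial).  Unitarity transports to the Gram matrix `G = H_P = ᵗσ(P) H P`: `σ(uᵢ) uⱼ Gᵢⱼ = Gᵢⱼ` (§1).  Hence EITHER both eigenvalues have NORM ONE
(`σ(uᵢ) uᵢ = 1`: the anisotropic torus `E¹ × E¹`, `G` diagonal), OR the pair is HYPERBOLIC: `σ(u₀) u₁ = 1`, `G₀₀ = G₁₁ = 0`, `G₀₁ ≠ 0` — the eigenvectors are isotropic and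
pair non-trivially (**`forall_norm_eq_one_or_hyperbolic`**).  In the hyperbolic case rescaling the second eigenvector by `G₀₁⁻¹` makes `G = antidiag(1, 1) = Φ₂`, i.e.
for `H = Φ₂` the rescaled frame `Q = P · diag(1, G₀₁⁻¹)` is ITSELF in `U(σ, Φ₂)` and `Q⁻¹ γ Q = diag(u)` lies in the diagonal torus — a Levi subgroup
(**`exists_mem_unitaryGroup_antidiagTwo_eigenframe_of_not_norm_one`**).  §3 reads this on the CM carriers of the inert unit fundamental lemma: for `γ_H = (γ₂, γ₁) ∈ H_v =
U(Φ₂)_v × U(Φ₁)_v` at a NON-SPLIT `v` (so `E_v = L_w` is a field) with an eigenframe `(P, u)` of `γ₂` (★ (E1) `RankTwoEigenframeOfSplitCharpoly` from `hsplit`), the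
ELLIPTICITY hypothesis `hell : ¬ ∃ y d′, glDiagonal 2 d′ = (y γ_H y⁻¹).1` of `stub_countSplitClause` FORCES `σ_v(uᵢ) uᵢ = 1`
(**`forall_conjLocal_mul_eq_one_of_not_exists_conj_glDiagonal`**) — the `hu1` premise of ★ `LocalStableClassesNonsplitRankTwo`, ★ (L5) `UnitStableOrbitalIntegralHSideValue`,
★ (L5-d1) and B-p10's (E4) compact-centraliser lemma.

## References
* [Rogawski1990] J. D. Rogawski, *Automorphic Representations of Unitary Groups in Three Variables*, Ann. of Math. Stud. 123 (1990), §3.5 p. 29 (tori of `U(2)`: `E¹ × E¹`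
  vs `E^×`), §3.6 p. 31.
* [Flicker1998UnitaryFL] Y. Z. Flicker, *Elementary proof of the fundamental lemma for a unitary group*, Canad. J. Math. 50 (1998), §6 p. 95 (`T_H = (E¹)²`).
* [Scharlau1985HermitianForms] W. Scharlau, *Quadratic and Hermitian Forms*, Grundlehren 270 (1985), Ch. 7 §6 (isotropic vectors and hyperbolic planes for hermitian forms).
-/

set_option autoImplicit false

noncomputable section

open Matrix NumberField IsDedekindDomain
open scoped MatrixGroups

namespace Literature.NumberTheory.Rogawski1990

open Literature.AlgebraicGeometry.ShimuraVarieties Literature.NumberTheory.Automorphic Literature.NumberTheory.Automorphic.UnitaryGroup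
open Literature.NumberTheory.GaloisRepresentations

/-! ## §1 Over a field: unitarity on the Gram matrix of an eigenframe; norm one or hyperbolic -/

section Field

variable {K : Type*} [Field K] (σ : K →+* K) (H : Matrix (Fin 2) (Fin 2) K)

/-- **Unitarity on the Gram matrix of an eigenframe**: `γ ∈ U(σ, H)`, `γ P = P · diag(u)` ⇒ `σ(uᵢ) · uⱼ · (H_P)ᵢⱼ = (H_P)ᵢⱼ` (`H_{γP} = H_P` and `H_{P diag u} = ᵗσ(diag u) H_P diag u`).
[cite: Rogawski1990, §3.5 p. 29] -/
theorem map_mul_mul_twistGram_eigenframe_apply {γ P : GL (Fin 2) K} {u : Fin 2 → K} (hγ : γ ∈ unitaryGroup σ H)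
    (hP : γ.val * P.val = P.val * diagonal u) (i j : Fin 2) :
    σ (u i) * u j * twistGram σ H P.val i j = twistGram σ H P.val i j := by
  have h1 : twistGram σ H (γ.val * P.val) = twistGram σ H P.val := twistGram_unitary_mul σ H hγ _
  have h2 : twistGram σ H (P.val * diagonal u) = (diagonal fun m => σ (u m)) * twistGram σ H P.val * diagonal u := by
    rw [twistGram_mul, diagonal_map (map_zero σ), diagonal_transpose]
  rw [hP, h2] at h1
  have h := congrFun (congrFun h1 i) j
  rw [mul_diagonal, diagonal_mul] at h
  linear_combination h

/-- The eigenvalues of an invertible matrix are non-zero: `γ P = P · diag(u)`, `γ, P ∈ GL₂` ⇒ `uᵢ ≠ 0` (`det γ = u₀ u₁`). [cite: HornJohnson2013, §1.1 Thm. 1.1.6 + Problem 1.1.P5 (0 ∉ spectrum ⟺ nonsingular)] -/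
theorem eigenvalue_ne_zero_of_eigenframe {γ P : GL (Fin 2) K} {u : Fin 2 → K} (hP : γ.val * P.val = P.val * diagonal u) (i : Fin 2) : u i ≠ 0 := by
  have h := congrArg Matrix.det hP
  rw [det_mul, det_mul, det_diagonal] at h
  have hP0 : P.val.det ≠ 0 := fun h0 => by simpa [h0] using (Matrix.isUnit_iff_isUnit_det _).1 P.isUnit
  have hγ0 : γ.val.det ≠ 0 := fun h0 => by simpa [h0] using (Matrix.isUnit_iff_isUnit_det _).1 γ.isUnit
  have hprod : ∏ k, u k ≠ 0 := by
    intro h0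
    rw [h0, mul_zero] at h
    exact mul_ne_zero hγ0 hP0 h
  exact (Finset.prod_ne_zero_iff.1 hprod) i (Finset.mem_univ i)

/-- **NORM ONE OR HYPERBOLIC**: for `γ ∈ U(σ, H)` (`H` hermitian non-degenerate, `σ` an involution) with an eigenframe `γ P = P · diag(u)`, `u₀ ≠ u₁`: EITHER `σ(uᵢ) uᵢ = 1` for
both `i` (anisotropic torus `E¹ × E¹`), OR `σ(u₀) u₁ = 1` with `(H_P)₀₀ = (H_P)₁₁ = 0` and `(H_P)₀₁ ≠ 0` (hyperbolic pair of isotropic eigenvectors).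
[cite: Rogawski1990, §3.5 p. 29] [cite: Scharlau1985HermitianForms, Ch. 7 §6] -/
theorem forall_norm_eq_one_or_hyperbolic (hσ : ∀ r : K, σ (σ r) = r) (hH : (H.map σ)ᵀ = H) (hHd : H.det ≠ 0) {γ P : GL (Fin 2) K} {u : Fin 2 → K}
    (hγ : γ ∈ unitaryGroup σ H) (hP : γ.val * P.val = P.val * diagonal u) (hu : Function.Injective u) :
    (∀ i, σ (u i) * u i = 1) ∨
      (σ (u 0) * u 1 = 1 ∧ twistGram σ H P.val 0 0 = 0 ∧ twistGram σ H P.val 1 1 = 0 ∧ twistGram σ H P.val 0 1 ≠ 0) := by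
  set G := twistGram σ H P.val with hG
  have hrel := map_mul_mul_twistGram_eigenframe_apply σ H hγ hP
  -- `G` is hermitian and non-degenerate
  have hGh : (G.map σ)ᵀ = G := conjTranspose_twistGram σ H hσ hH P.val
  have hG10 : G 1 0 = σ (G 0 1) := by
    have h := congrFun (congrFun hGh 1) 0
    rw [transpose_apply, map_apply] at h
    exact h.symm
  have hGd : G.det ≠ 0 := by
    rw [hG, det_twistGram]
    have hP0 : P.val.det ≠ 0 := fun h0 => by simpa [h0] using (Matrix.isUnit_iff_isUnit_det _).1 P.isUnit
    exact mul_ne_zero (mul_ne_zero ((map_ne_zero σ).2 hP0) hHd) hP0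
  have hdet : G.det = G 0 0 * G 1 1 - G 0 1 * G 1 0 := Matrix.det_fin_two G
  have h01 := eigenvalue_ne_zero_of_eigenframe hP
  by_cases h0 : σ (u 0) * u 0 = 1
  · by_cases h1 : σ (u 1) * u 1 = 1
    · exact Or.inl fun i => by fin_cases i <;> assumption
    · -- `G₁₁ = 0`, so `G₀₁ G₁₀ ≠ 0`, so `σ(u₀) u₁ = 1 = σ(u₀) u₀`: contradiction with `u₀ ≠ u₁`
      exfalso
      have hG11 : G 1 1 = 0 := by
        have h := hrel 1 1
        have h' : (σ (u 1) * u 1 - 1) * G 1 1 = 0 := by linear_combination h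
        exact (mul_eq_zero.1 h').resolve_left (sub_ne_zero.2 h1)
      have hG01 : G 0 1 ≠ 0 := fun h00 => hGd (by rw [hdet, hG11, h00]; ring)
      have h01' : σ (u 0) * u 1 = 1 := by
        have h := hrel 0 1
        have h' : (σ (u 0) * u 1 - 1) * G 0 1 = 0 := by linear_combination h
        exact sub_eq_zero.1 ((mul_eq_zero.1 h').resolve_right hG01)
      have hσ0 : σ (u 0) ≠ 0 := fun hz => by rw [hz, zero_mul] at h0; exact zero_ne_one h0
      exact hu.ne (show (0 : Fin 2) ≠ 1 by decide) (mul_left_cancel₀ hσ0 (h0.trans h01'.symm))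
  · -- `G₀₀ = 0`, so `G₀₁ ≠ 0`, `σ(u₀) u₁ = 1`, `σ(u₁) u₀ = 1`, and then `σ(u₁) u₁ ≠ 1`, `G₁₁ = 0`
    have hG00 : G 0 0 = 0 := by
      have h := hrel 0 0
      have h' : (σ (u 0) * u 0 - 1) * G 0 0 = 0 := by linear_combination h
      exact (mul_eq_zero.1 h').resolve_left (sub_ne_zero.2 h0)
    have hG01 : G 0 1 ≠ 0 := fun h00 => hGd (by rw [hdet, hG00, h00]; ring)
    have hG10' : G 1 0 ≠ 0 := by rw [hG10]; exact (map_ne_zero σ).2 hG01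
    have h01' : σ (u 0) * u 1 = 1 := by
      have h := hrel 0 1
      have h' : (σ (u 0) * u 1 - 1) * G 0 1 = 0 := by linear_combination h
      exact sub_eq_zero.1 ((mul_eq_zero.1 h').resolve_right hG01)
    have h10' : σ (u 1) * u 0 = 1 := by
      have h := hrel 1 0
      have h' : (σ (u 1) * u 0 - 1) * G 1 0 = 0 := by linear_combination h
      exact sub_eq_zero.1 ((mul_eq_zero.1 h').resolve_right hG10')
    have h1 : σ (u 1) * u 1 ≠ 1 := by
      intro h1
      have hσ1 : σ (u 1) ≠ 0 := fun hz => by rw [hz, zero_mul] at h1; exact zero_ne_one h1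
      exact hu.ne (show (1 : Fin 2) ≠ 0 by decide) (mul_left_cancel₀ hσ1 (h1.trans h10'.symm))
    have hG11 : G 1 1 = 0 := by
      have h := hrel 1 1
      have h' : (σ (u 1) * u 1 - 1) * G 1 1 = 0 := by linear_combination h
      exact (mul_eq_zero.1 h').resolve_left (sub_ne_zero.2 h1)
    exact Or.inr ⟨h01', hG00, hG11, hG01⟩

/-- **THE HYPERBOLIC CASE IS A LEVI CLASS** (`H = Φ₂ = antidiag(1, 1)`): if `γ ∈ U(σ, Φ₂)` has an eigenframe `γ P = P · diag(u)`, `u₀ ≠ u₁`, whose eigenvalues are NOT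
both of norm one, then the rescaled frame `Q = P · diag(1, (H_P)₀₁⁻¹)` lies in `U(σ, Φ₂)` and `γ Q = Q · diag(u)` — `γ` is `U(Φ₂)`-conjugate to the diagonal element
`diag(u₀, u₁)` of the torus `E^× ↪ U(1,1)`. [cite: Rogawski1990, §3.5 p. 29; §3.6 p. 31] [cite: Scharlau1985HermitianForms, Ch. 7 §6] -/
theorem exists_mem_unitaryGroup_antidiagTwo_eigenframe_of_not_norm_one (hσ : ∀ r : K, σ (σ r) = r) {γ P : GL (Fin 2) K} {u : Fin 2 → K}
    (hγ : γ ∈ unitaryGroup σ (Matrix.of fun i j : Fin 2 => if i.val + j.val + 1 = 2 then (1 : K) else 0))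
    (hP : γ.val * P.val = P.val * diagonal u) (hu : Function.Injective u) (hnot : ¬ ∀ i, σ (u i) * u i = 1) :
    (σ (u 0) * u 1 = 1 ∧ σ (u 1) * u 0 = 1) ∧
    ∃ Q : GL (Fin 2) K, Q ∈ unitaryGroup σ (Matrix.of fun i j : Fin 2 => if i.val + j.val + 1 = 2 then (1 : K) else 0) ∧
      γ.val * Q.val = Q.val * diagonal u := by
  have hΦh : ((Matrix.of fun i j : Fin 2 => if i.val + j.val + 1 = 2 then (1 : K) else 0).map σ)ᵀ =
      Matrix.of fun i j : Fin 2 => if i.val + j.val + 1 = 2 then (1 : K) else 0 := by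
    ext i j
    fin_cases i <;> fin_cases j <;> simp [Matrix.of_apply]
  have hΦd : (Matrix.of fun i j : Fin 2 => if i.val + j.val + 1 = 2 then (1 : K) else 0).det ≠ 0 := by
    rw [Matrix.det_fin_two]
    simp [Matrix.of_apply]
  obtain ⟨G, hG⟩ : ∃ G, twistGram σ (Matrix.of fun i j : Fin 2 => if i.val + j.val + 1 = 2 then (1 : K) else 0) P.val = G := ⟨_, rfl⟩
  rcases forall_norm_eq_one_or_hyperbolic σ _ hσ hΦh hΦd hγ hP hu with h | ⟨h01, hG00, hG11, hG01⟩
  · exact absurd h hnot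
  rw [hG] at hG00 hG11 hG01
  have h10 : σ (u 1) * u 0 = 1 := by
    have h := congrArg σ h01
    rw [map_mul, hσ, map_one, mul_comm] at h
    exact h
  have hGh : (G.map σ)ᵀ = G := hG ▸ conjTranspose_twistGram σ _ hσ hΦh P.val
  have hG10 : G 1 0 = σ (G 0 1) := by
    have h := congrFun (congrFun hGh 1) 0
    rw [transpose_apply, map_apply] at h
    exact h.symm
  -- the rescaling `D = diag(1, G₀₁⁻¹)`
  have hcdet : (diagonal (![1, (G 0 1)⁻¹] : Fin 2 → K)).det ≠ 0 := by
    rw [det_diagonal, Fin.prod_univ_two, cons_val_zero, cons_val_one]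
    simp [hG01]
  let D : GL (Fin 2) K := Matrix.GeneralLinearGroup.mkOfDetNeZero _ hcdet
  have hD : (D : Matrix (Fin 2) (Fin 2) K) = diagonal ![1, (G 0 1)⁻¹] := rfl
  refine ⟨⟨h01, h10⟩, P * D, ?_, ?_⟩
  · -- `H_{PD} = ᵗσ(D) G D = Φ`
    rw [← twistGram_coe_eq_iff_mem_unitaryGroup, Units.val_mul, twistGram_mul, hG, hD, diagonal_map (map_zero σ), diagonal_transpose]
    ext i j
    rw [mul_diagonal, diagonal_mul, Matrix.of_apply]
    fin_cases i <;> fin_cases j <;> simp only [Fin.zero_eta, Fin.mk_one, Fin.isValue]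
    · simp [hG00]
    · simp [hG01]
    · simp [hG10, hG01]
    · simp [hG11]
  · rw [Units.val_mul, ← Matrix.mul_assoc, hP, Matrix.mul_assoc, Matrix.mul_assoc, hD, diagonal_mul_diagonal, diagonal_mul_diagonal]
    congr 2
    funext k
    exact mul_comm _ _

end Field

/-! ## §2 The CM carriers: ellipticity (`hell`) forces norm-one eigenvalues at a non-split place -/

section CM

variable (L : Type) [Field L] [NumberField L] [IsCMField L] (v : HeightOneSpectrum (𝓞 ↥(maximalRealSubfield L)))
  (w : PlacesOver L v) (hw : IsCMField.complexConj L • w.1 = w.1)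

omit [IsCMField L] in
/-- The local form of `Φ₂` over `E_v` is the literal `antidiag(1, 1)`. [cite: Rogawski1990, §3.5 p. 29] -/
private theorem antidiagTwo_map_algebraMap :
    (Matrix.of fun i j : Fin 2 => if i.val + j.val + 1 = 2 then (1 : L) else 0).map (algebraMap L (LocalRing L v)) =
      Matrix.of fun i j : Fin 2 => if i.val + j.val + 1 = 2 then (1 : LocalRing L v) else 0 := by
  ext i j
  simp only [map_apply, of_apply]
  split_ifs <;> simp

include hw in
/-- **(E3) ELLIPTICITY FORCES NORM-ONE EIGENVALUES.**  For `γ_H = (γ₂, γ₁) ∈ H_v = U(Φ₂)_v × U(Φ₁)_v` at a NON-SPLIT place `v` (`w ∣ v`, `c • w = w`) and an eigenframe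
`γ₂ P = P · diag(u)` over `E_v` with `u₀ ≠ u₁` (★ (E1) from `hsplit`), the hypothesis `hell` of `stub_countSplitClause` — «no `H_v`-conjugate of `γ_H` has diagonal
`U(Φ₂)`-part `glDiagonal 2 d′`» — gives `σ_v(uᵢ) · uᵢ = 1` for both `i`: otherwise §1 conjugates `γ₂` INSIDE `U(Φ₂)_v` to `diag(u₀, u₁) = glDiagonal 2 d′`.
[cite: Rogawski1990, §3.5 p. 29; §3.6 p. 31] [cite: Flicker1998UnitaryFL, §6 p. 95] -/
theorem forall_conjLocal_mul_eq_one_of_not_exists_conj_glDiagonal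
    {γH : (cmDatum L 2 (Matrix.of fun i j : Fin 2 => if i.val + j.val + 1 = 2 then (1 : L) else 0)).Local v ×
      (cmDatum L 1 (Matrix.of fun i j : Fin 1 => if i.val + j.val + 1 = 1 then (1 : L) else 0)).Local v}
    {P : GL (Fin 2) (LocalRing L v)} {u : Fin 2 → LocalRing L v}
    (hP : (γH.1.val.val : Matrix (Fin 2) (Fin 2) (LocalRing L v)) * P.val = P.val * diagonal u)
    (hu : Function.Injective u)
    (hell : ¬ ∃ (y : (cmDatum L 2 (Matrix.of fun i j : Fin 2 => if i.val + j.val + 1 = 2 then (1 : L) else 0)).Local v ×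
      (cmDatum L 1 (Matrix.of fun i j : Fin 1 => if i.val + j.val + 1 = 1 then (1 : L) else 0)).Local v) (d' : Fin 2 → (LocalRing L v)ˣ),
        glDiagonal 2 (LocalRing L v) d' = ((y * γH * y⁻¹).1.val : GL (Fin 2) (LocalRing L v))) :
    ∀ i, conjLocal L (IsCMField.complexConj L) v (u i) * u i = 1 := by
  have hc1 : IsCMField.complexConj L ≠ 1 := IsCMField.complexConj_ne_one L
  letI : Field (LocalRing L v) := (LocalRing.isField_of_smul_eq (IsCMField.complexConj L) hc1 w hw).toField
  have hσσ : ∀ s, conjLocal L (IsCMField.complexConj L) v (conjLocal L (IsCMField.complexConj L) v s) = s := fun s => by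
    rw [LocalRing.eq_iff_apply_eq (IsCMField.complexConj L) hc1 w hw, conjLocal_apply_eq_galAdicCompletionMap L v w hw,
      conjLocal_apply_eq_galAdicCompletionMap L v w hw]
    exact galAdicCompletionMap_galAdicCompletionMap_of_smul_eq (IsCMField.complexConj L) w hc1 hw (s w)
  by_contra hnot
  rw [not_forall] at hnot
  obtain ⟨i₀, hi₀⟩ := hnot
  -- `γ₂ ∈ U(σ_v, Φ₂)` as a literal matrix group over `E_v`
  have hmem : (γH.1.val : GL (Fin 2) (LocalRing L v)) ∈
      unitaryGroup (conjLocal L (IsCMField.complexConj L) v) (Matrix.of fun i j : Fin 2 => if i.val + j.val + 1 = 2 then (1 : LocalRing L v) else 0) := by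
    have h : (γH.1.val : GL (Fin 2) (LocalRing L v)) ∈ unitaryGroupOfForm (conjLocal L (IsCMField.complexConj L) v)
        ((Matrix.of fun i j : Fin 2 => if i.val + j.val + 1 = 2 then (1 : L) else 0).map (algebraMap L (LocalRing L v))) := by
      rw [← local_eq_unitaryGroupOfForm_map]
      exact γH.1.property
    rw [antidiagTwo_map_algebraMap] at h
    exact h
  obtain ⟨⟨h01, h10⟩, Q, hQ, hQP⟩ := exists_mem_unitaryGroup_antidiagTwo_eigenframe_of_not_norm_one (conjLocal L (IsCMField.complexConj L) v) hσσ hmem hP hu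
    (fun h => hi₀ (h i₀))
  -- `Q` as an element of `U(Φ₂)_v`, and the conjugate `Q⁻¹ γ₂ Q = diag(u)`
  have hQ' : Q ∈ «local» L (IsCMField.complexConj L) 2 (Matrix.of fun i j : Fin 2 => if i.val + j.val + 1 = 2 then (1 : L) else 0) v := by
    rw [local_eq_unitaryGroupOfForm_map, antidiagTwo_map_algebraMap]
    exact hQ
  let q : (cmDatum L 2 (Matrix.of fun i j : Fin 2 => if i.val + j.val + 1 = 2 then (1 : L) else 0)).Local v := ⟨Q, hQ'⟩
  -- the eigenvalues as units (explicit inverses from the hyperbolic relations; no division)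
  let d' : Fin 2 → (LocalRing L v)ˣ := fun i =>
    ⟨u i, (![conjLocal L (IsCMField.complexConj L) v (u 1), conjLocal L (IsCMField.complexConj L) v (u 0)] : Fin 2 → LocalRing L v) i,
      by fin_cases i <;> simp only [Fin.zero_eta, Fin.mk_one, Fin.isValue, cons_val_zero, cons_val_one, cons_val_fin_one, mul_comm (u _)] <;> assumption,
      by fin_cases i <;> simp only [Fin.zero_eta, Fin.mk_one, Fin.isValue, cons_val_zero, cons_val_one, cons_val_fin_one] <;> assumption⟩
  refine hell ⟨(q⁻¹, 1), d', ?_⟩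
  apply Units.ext
  rw [coe_glDiagonal]
  change (diagonal fun k => u k) = ((Q⁻¹).val * (γH.1.val.val : Matrix (Fin 2) (Fin 2) (LocalRing L v)) * Q.val : Matrix (Fin 2) (Fin 2) (LocalRing L v))
  rw [Matrix.mul_assoc, hQP, ← Matrix.mul_assoc, Units.inv_mul, Matrix.one_mul]

end CM

end Literature.NumberTheory.Rogawski1990

end
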